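import Summits.HodgeConjecture.HodgeConjecture.Theses.HeckePrymWeil
import Literature.AlgebraicGeometry.Motives.AbelianVarietyProjectiveChart
import Literature.AlgebraicGeometry.HodgeTheory.HodgeModelExistence

/-!
# Disproof attempts on crux `SummitOffWeilSector` (item stmt-HodgeConjecture-14374, route HeckePrymWeil) — findings

Standing-adversary work file. Cycle 2 (seat `refuter-cdisprove-stmt-HodgeConjecture-14374-0`,
2026-08-16) EXTENDS cycle 1 (seat `refuter-cdisprove-stmt-HodgeConjecture-1264-0`, same day) after the
planner RE-FILED the item (rev 4: stmt-HodgeConjecture-1264 → stmt-HodgeConjecture-14374; the `def`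
body is unchanged symbol for symbol — `A.dim = 2 * n` vs `(2 * n)` and `Real.sqrt ↑p` vs
`Real.sqrt (p : ℝ)` are the same terms: §0 `summitOffWeilSector_iff` is still `Iff.rfl`, probe
`W.lean` rc 0 — only the badge changed to "CLAIMED, conjecture-grade, ranked last"). Everything
outside `-- NEAR-MISSES` is `lean check`ed (rc 0, no `sorry`). LANDED on the negative lane:
`Theorems/SummitOffWeilSector/Negative/ConjectureGrade.lean` (= §1–§2, p76424, cycle 1) and
`Theorems/SummitOffWeilSector/Negative/RouteComplement.lean` (= §2b, this cycle; proposal id in the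
seat's NOTES.md / the item's evidence trail).

## The statement (probe `W.lean`, rc 0; body re-read by `Iff.rfl`, §0)

`SummitOffWeilSector := WeilSector → HodgeConjecture`, where `WeilSector` (§0, verbatim antecedent) is
the ℚ(√-p) Hodge–Weil sector: for every prime `p ≡ 3 (4)`, `p ≥ 7`, every `n ≥ 1`, every complex abelian
variety `A` (`Motives.AbelianVariety ℂ` — a REAL structure: proper geometrically-integral group scheme
over `Spec ℂ`) with `A.dim = 2n` and `φ : A ⟶ A`, `φ ≫ φ = -(p • 𝟙 A)` (Mathlib-transported preadditive
structure), every rational class `c ∈ H²ⁿ(A(ℂ); ℂ)` of Hodge type `(n,n)` (`IsOfHodgeType (2n) A.X (2n) n n`: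
`∃` Hodge model) lying in `Eig((𝟙+φ)^*, (1+i√p)²ⁿ) ⊔ Eig((𝟙+φ)^*, (1-i√p)²ⁿ)` is in
`algebraicClasses A.X n = Nⁿ H²ⁿ(A(ℂ); ℂ)`; and `HodgeConjecture` is the summit (Deligne 2000, all smooth
projective `X/ℂ`). Rev 4 files it as a CLAIMED conjecture-grade crux so that
`closes : HodgeWeilLadder → WeilDescending → SummitOffWeilSector → HodgeConjecture` has exactly the
route's items as hypotheses.

## Verdict after two cycles: NO KILL

A kill is provably a disproof of the Clay problem (§1–§2); the crux is EXACTLY "the rest of the route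
implies the summit" (§2b, new); and the only junk vector is the uninhabitability of `HodgeModel`, i.e.
the negation of a printed theorem (§5, reworked).

1. `summitOffWeilSector_of_hodgeConjecture` : `HodgeConjecture → SummitOffWeilSector` (one line), hence
   `not_hodgeConjecture_of_not_summitOffWeilSector` : any refutation of the crux refutes the Hodge
   conjecture itself.
2. `weilSector_of_hodgeConjecture` : `HodgeConjecture → WeilSector` (PROVED, unconditional; uses the
   tree's proved `AbelianVariety.isSmoothProjective_holds`, axioms `propext/choice/Quot.sound`). Hence
   `not_summitOffWeilSector_iff` : `¬ SummitOffWeilSector ↔ (WeilSector ∧ ¬ HodgeConjecture)` and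
   `summitOffWeilSector_iff_or` : `SummitOffWeilSector ↔ (HodgeConjecture ∨ ¬ WeilSector)`.
   READING: to kill the crux one must (a) exhibit a counterexample to the Hodge conjecture AND (b) prove
   that every ℚ(√-p) Hodge–Weil class (p ≡ 3 (4), p ≥ 7, every dimension, every discriminant) is
   algebraic. Conversely the crux is PROVABLE only by proving `HodgeConjecture` outright or by refuting
   `WeilSector` (which, by item 2, also refutes `HodgeConjecture` and breaks the route).
3. (NEW, cycle 2, §2b) THE ANTECEDENT IS EXACTLY THE ROUTE'S POSITIVE WORK:
   `weilSector_iff_ladder_and_descending` : `WeilSector ↔ (HodgeWeilLadder ∧ WeilDescending)` (→: rungs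
   `g' ≥ 2` and the descending step are instances of the sector; ←: the ladder descent of the deciding
   theorem `closes`, isolated as `ladder_descent`). Consequently
   `summitOffWeilSector_iff_routeCore` : `SummitOffWeilSector ↔ (HodgeWeilLadder → WeilDescending →
   HodgeConjecture)` and `not_summitOffWeilSector_iff_route` : `¬ SummitOffWeilSector ↔ (HodgeWeilLadder ∧
   WeilDescending ∧ ¬ HodgeConjecture)`. So the crux IS the route's own deciding implication with itself
   deleted: `closes hL hD hS = hS (sector hL hD)` is circular by construction (`assembly_tautology`), the
   route item `Assembly` is a tautology, and the route {Ladder, Descending, OffSector} is logically the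
   set {Ladder, Descending, HodgeConjecture}. For the gate/planner: a refutation of THIS crux = (the
   route's target and support both PROVED) ∧ (the summit REFUTED) — it can never come from the
   Hecke–Prym side, and it cannot come before `HodgeWeilLadder` is a theorem. With the route's rev 10–13
   glue item `LadderGlue` the same holds under ALL its other items
   (`summitOffWeilSector_iff_hodgeConjecture_of_route : LadderGlue → HeckePrymAnchors →
   WeilVariationalHodge → IsoInvariance → ProductDescent → WeilDescending → (SummitOffWeilSector ↔
   HodgeConjecture)`): the whole positive route done, the crux is the summit verbatim.
3b. (NEW, §2c) SANDWICH `HC → crux → (HC_ab → HC)`: granting the Hodge conjecture for ALL abelian varieties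
   (`HodgeConjectureForAbelianVarieties`, which contains the sector: `weilSector_of_hcAbelian`), the crux still
   asserts HC for every variety (`abelian_to_all_of_summitOffWeilSector`); so it is at least the
   abelian-to-all reduction, for which nothing is in print, and `HC_ab ∧ ¬HC → ¬crux`
   (`not_summitOffWeilSector_of_hcAbelian_of_not_hc`).
4. LOAD-BEARING ANALYSIS (§3). The crux has ONE hypothesis, `WeilSector`; dropping it leaves
   `HodgeConjecture`. Hypotheses INSIDE the antecedent are ANTI-load-bearing
   (`variant_of_stronger_antecedent`): weakening `WeilSector`'s own hypotheses makes the antecedent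
   stronger and the crux weaker. Recorded: (i) `1 ≤ n` is decoration — the `n = 0` rung is TRUE outright
   (`weilRung_zero`, via `algebraicClasses_zero`), `summitOffWeilSector_iff_withZero`; (ii) dropping
   `IsOfHodgeType` from the antecedent makes the antecedent FALSE on paper (`A = E²ⁿ`, `E` CM by
   `ℤ[(1+√-p)/2]`, `φ = diag(√-p)`: the Weil plane is `H^{2n,0} ⊕ H^{0,2n}`, rational, not algebraic), so
   that variant of the crux is TRUE ex falso on paper and not a route to anything; (iii) dropping
   `IsRationalClass` changes nothing on Weil type (the Weil plane is ℚ-spanned; `algebraicClasses` is a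
   ℂ-subspace); (iv) (new) the restriction `p ≡ 3 (4)` is forced by the mechanism (ℚ[μ\F_p/μ] ≅ ℚ × ℚ(√p*),
   `p* = -p` iff `p ≡ 3 (4)`), so the OFF-sector complement also contains the Weil classes of
   `K = ℚ(√-p)` for the primes `p ≡ 1 (4)` (5, 13, 17, …): the item's informal gloss ("K = ℚ(i), ℚ(√-2),
   ℚ(√-3) and composite -d") under-lists the complement. Harmless for the formal statement (the
   complement is `HodgeConjecture` itself); noted for the planner.
5. TYPING OF THE ANTECEDENT IS FAITHFUL FOR ALL RUNGS (§4, PROVED for all `n`): `weil_pow_ne_conj_pow` :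
   for a prime `p ≠ 3` and every `n ≥ 1`, `(1 + i√p)ⁿ ≠ (1 - i√p)ⁿ`, by an elementary descent on `n`;
   hence the two Weil eigenvalues `(1 ± i√p)²ⁿ` are distinct and differ from every mixed Künneth–Hodge
   eigenvalue (`mixed_ne_pure_pos/neg`), i.e. `c ∈ Eig ⊔ Eig` cuts out exactly
   `W_K ⊗ ℂ = ∧²ⁿH¹_σ ⊕ ∧²ⁿH¹_σ̄` in every dimension; the excluded prime `p = 3` genuinely fails
   (`weilAB_three_three`). [Landed equivalents by sibling seats, which provers should import:
   `Theorems/WeilTwelvefoldsSqrtMinus7/Negative/LadderTyping.lean` (`one_add_I_sqrt_pow_ne`) and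
   `Theorems/WeilTenfoldsSqrtMinus11/Negative/EigenvalueSeparation.lean` (`weil_plus_pow_ne_minus_pow`).]
6. JUNK / SMALL MODELS (§5, REWORKED in cycle 2). Both halves of a kill hinge on ONE interface:
   `IsOfHodgeType … c := ∃ M : HodgeModel n X, …` and `HodgeConjectureFor n X := Nonempty (HodgeModel n X)
   ∧ …`. THE junk vector, made precise and checked: IF Hodge models of positive-dimensional abelian
   varieties were uninhabitable (`h₁`), the whole sector would hold VACUOUSLY
   (`weilSector_of_isEmpty_hodgeModel`) and, given one positive-dimensional abelian variety (`h₂`), the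
   summit would FAIL at it (`not_hodgeConjecture_of_isEmpty_hodgeModel`), so the crux would die
   (`not_summitOffWeilSector_of_isEmpty_hodgeModel : h₁ → h₂ → ¬ SummitOffWeilSector`). But `h₁ ∧ h₂`
   refutes the Literature named fact `HodgeTheory.nonempty_hodgeModel` (Serre GAGA §2 + de Rham + Hodge
   decomposition; `isEmpty_hodgeModel_contradicts_namedFact`), so this is NOT a `--negative-modulo H`
   candidate (H is false on paper) — it records that the junk-safety of crux AND summit is carried by
   that one fact. Audit of the interface this cycle (files read, not just cited):
   `IsAnalytification` (Transcendental/Analytification.lean:348) = homeomorphism + `finrank model = n` +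
   regular functions pull back to `MDifferentiableOn 𝓘(ℂ)` functions — pins the complex structure (the
   conjugate structure is excluded; an equidimensional injective holomorphic map is biholomorphic);
   `ComplexDeRhamIsoFamily model` (DeRhamTheorem.lean:482) quantifies over genuine manifolds only
   (`ChartedSpace` + `IsManifold 𝓘(ℝ,E) ∞` + `T2` + `SigmaCompact`, finite-dimensional model ⇒
   paracompact, second countable), and the form calculus is frame-correct (`MForm.inChart` composes
   with `mfderivWithin 𝓘(ℝ,E) I (extChartAt I x₀).symm`, ManifoldForms.lean:107; `cexactSmoothForms 0 =
   ⊥`); `IsOfType p q` (ComplexForms.lean:180) = `p + q = k` ∧ U(1)-weight `p - q`, which for fixed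
   `p + q` singles out exactly the `(p,q)`-forms; `supportedClasses` measures codimension pointwise by
   `Order.coheight z = dim 𝒪_{X,z}` (Mathlib `ringKrullDim_stalk_eq_coheight`). No field is
   contradictory; de Rham's theorem and the Hodge decomposition inhabit the interface classically, so
   `IsEmpty (HodgeModel n X)` is unprovable for smooth projective `X` unless the tree's calculus is
   inconsistent. Constructible models today: none of positive dimension (`nonempty_hodgeModel`,
   `exists_complexDeRhamIsoFamily`, `isInternal_hodgePQ` are named facts; the analytification of `E_τ³`
   IS constructed, `Barriers/…/GeneralizedHodgeTrivialReasonsEllipticCurveCubedModel.lean`). The other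
   junk direction — an EXOTIC model enlarging `H^{p,p}` — could only make `WeilSector` harder and is
   excluded on paper by the uniqueness argument in `RationalHodgeClasses` (analytification unique up to
   biholomorphism; natural automorphisms of `Hᵏ(–;ℂ)` on `2n`-manifolds are scalars — re-derived on
   paper this cycle: Thom realisability by `N × ℝ^{2n-k}` and a degree-one pinch `N → Sᵏ`).
7. NATURAL STRENGTHENINGS (§6, cycle 2): none is Lean-refutable. Strengthening the conclusion (integral /
   Kähler / generalized Hodge) leaves the statement's vocabulary (the catalogued counterexamples
   `Barriers/HodgeConjecture/IntegralCoefficients*`, `KaehlerCounterexamples*`,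
   `GeneralizedHodgeTrivialReasons*` are about other predicates); strengthening the antecedent weakens the
   crux (§3); weakening the antecedent (allow `p = 3`, `p ≡ 1 (4)`, all imaginary quadratic `K`) gives
   cruxes between `SummitOffWeilSector` and `HodgeConjecture`, all HC-implied, none refutable. Dropping
   `IsOfHodgeType` ∧ `IsRationalClass` ∧ the eigenspace condition from a rung ("every class in `H²ⁿ(A)` is
   algebraic") is false on paper (`H^{2n,0} ≠ 0`) but not in Lean: non-membership in `supportedClasses`
   needs a computed restriction map in singular cohomology, which the tree has for no `X` of positive
   dimension.
8. BARRIERS / LITERATURE. `Literature.Barriers.HodgeConjecture.Andre1996_hodgeClassesOnAbelianVarieties_motivated`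
   / Deligne 1982: Hodge classes on abelian varieties are motivated / absolute Hodge, so `¬ WeilSector`
   would contradict the standard conjecture B; `¬ HodgeConjecture` is the Clay problem. Both halves of a
   kill (item 2) are out of reach of every catalogued technique; none is evaded by anything in this file.
   Cycle 1 read vanGeemen1994HodgeAV pp. 215–220, 233–234 (Weil type as THE test case; isogeny
   invariance Lemma 3.7). No printed candidate mechanism for a NON-algebraic rational Hodge class on a
   smooth projective variety exists (the known failures — integral coefficients, Kähler non-projective,
   Grothendieck's generalized form — are excluded by the summit's rational/projective wording,
   Statement.lean quoting Deligne 2000 §2 (iv)–(v)). Cycle 2 literature re-check (2026-08-16, `lit search`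
   2023+, crossref + arXiv; OpenAlex/S2 rate-limited): the only disproof claims are unrefereed, uncited
   SSRN/techrxiv postings (doi:10.2139/ssrn.5180689 "via the Fermat quintic" — but HC is a theorem for all
   smooth projective threefolds (Lefschetz (1,1) + hard Lefschetz) and for Fermat hypersurfaces of prime
   degree (Shioda 1979, Ran 1980; tree: `HodgeTheory/FermatHodgeConjecture*`); doi:10.36227/techrxiv.171208950
   "by graph theory"), none usable as a witness; the current survey Voisin 2025 (J. Open Math. Problems,
   doi:10.56994/jomp.001.001.002) treats HC and GHC as open.
9. TARGETS: none (`payload.targets = []`, `stuck_stubs = []`; no line picked — the r1 triage panel failed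
   the only crux idea `weil-lefschetz-saturation` on scope; the gen-1 card `Ideas/weil-induction-anchors.md`
   declares itself a PARTIAL line, abelian part only). PRE-EMPTIVE NOTE for any line through the abelian
   part: by §2c its last stub is `HodgeConjectureForAbelianVarieties → HodgeConjecture`
   (`abelian_to_all_of_summitOffWeilSector`), i.e. HC for every non-abelian variety — summit-grade, no
   mechanism in print; §7 is reserved for stub kills on re-arm.

WHY IT RESISTS (for provers and the lead, two lines): the crux is `HodgeConjecture` weakened by a
hypothesis that `HodgeConjecture` itself implies and that no known argument converts into anything
off the ℚ(√-p) Weil sector; its negation is `Ladder ∧ Descending ∧ ¬HC`. Do not staff it; it closes as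
`fun h _ => h` from any proof of the summit, and every by-product worth importing is in §2/§2b/§4.
-/

noncomputable section

set_option linter.dupNamespace false

open CategoryTheory Complex

namespace Summit.HodgeConjecture.HodgeConjecture.Cruxes.SummitOffWeilSector.Disproof

open Literature.AlgebraicGeometry.Motives Literature.AlgebraicGeometry.HodgeTheory
open Summit.HodgeConjecture.HodgeConjecture.Theses.HeckePrymWeil

/-! ## §0 The crux elaborates; its antecedent named -/

/-- The rung predicate of the ℚ(√-p) Hodge–Weil sector in dimension `2n` (the common body of
`HodgeWeilLadder`, `WeilDescending` and the antecedent of `SummitOffWeilSector`). -/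
def WeilRung (p n : ℕ) : Prop :=
  ∀ (A : AbelianVariety ℂ) (φ : A ⟶ A), A.dim = (2 * n) → φ ≫ φ = -((p : ℤ) • 𝟙 A) →
    ∀ c : complexBetti A.X (2 * n), IsRationalClass c → IsOfHodgeType (2 * n) A.X (2 * n) n n c →
      c ∈ Module.End.eigenspace (complexBetti.map (𝟙 A + φ).hom.hom.hom (2 * n)).hom
            ((1 + I * (Real.sqrt (p : ℝ) : ℂ)) ^ (2 * n)) ⊔
          Module.End.eigenspace (complexBetti.map (𝟙 A + φ).hom.hom.hom (2 * n)).hom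
            ((1 - I * (Real.sqrt (p : ℝ) : ℂ)) ^ (2 * n)) →
      c ∈ algebraicClasses A.X n

/-- The antecedent of the crux: the whole ℚ(√-p) Hodge–Weil sector, `p ≡ 3 (4)`, `p ≥ 7`, `n ≥ 1`. -/
def WeilSector : Prop :=
  ∀ p : ℕ, p.Prime → p % 4 = 3 → 7 ≤ p → ∀ n : ℕ, 1 ≤ n → WeilRung p n

/-- Readback: the crux IS `WeilSector → HodgeConjecture`, definitionally. -/
theorem summitOffWeilSector_iff : SummitOffWeilSector ↔ (WeilSector → _root_.HodgeConjecture) :=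
  Iff.rfl

/-! ## §1 Any kill of the crux is a disproof of the Hodge conjecture -/

/-- `HodgeConjecture` implies the crux (the crux is an implication with conclusion `HodgeConjecture`). -/
theorem summitOffWeilSector_of_hodgeConjecture : _root_.HodgeConjecture → SummitOffWeilSector :=
  fun h _ => h

/-- Contrapositive: refuting `SummitOffWeilSector` refutes the Clay problem. -/
theorem not_hodgeConjecture_of_not_summitOffWeilSector :
    ¬ SummitOffWeilSector → ¬ _root_.HodgeConjecture :=
  mt summitOffWeilSector_of_hodgeConjecture

/-! ## §2 The antecedent is a special case of the conclusion; exact logical status -/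

/-- Every rung of the sector is a special case of the Hodge conjecture (abelian varieties are smooth
projective: the tree's PROVED `AbelianVariety.isSmoothProjective_holds`). -/
theorem weilRung_of_hodgeConjecture (hHC : _root_.HodgeConjecture) (p n : ℕ) : WeilRung p n := by
  intro A φ hdim _ c hrat hhodge _
  have hsp : IsSmoothProjective (2 * n) A.X := by
    have h := (AbelianVariety.isSmoothProjective_holds (A := A))
    rw [AbelianVariety.isSmoothProjective, hdim] at h
    exact h
  exact (hHC hsp).2 n c hrat hhodge

/-- `HodgeConjecture → WeilSector`. -/
theorem weilSector_of_hodgeConjecture (hHC : _root_.HodgeConjecture) : WeilSector :=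
  fun p _ _ _ n _ => weilRung_of_hodgeConjecture hHC p n

/-- EXACT STATUS: the crux fails iff the Weil sector holds and the Hodge conjecture fails. -/
theorem not_summitOffWeilSector_iff :
    ¬ SummitOffWeilSector ↔ (WeilSector ∧ ¬ _root_.HodgeConjecture) := by
  rw [summitOffWeilSector_iff, Classical.not_imp]

/-- Equivalent disjunctive form. -/
theorem summitOffWeilSector_iff_or :
    SummitOffWeilSector ↔ (_root_.HodgeConjecture ∨ ¬ WeilSector) := by
  rw [summitOffWeilSector_iff]
  exact imp_iff_or_not

/-- The two ways to PROVE the crux: prove HC, or refute the sector (which refutes HC as well). -/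
theorem summitOffWeilSector_of_not_weilSector (h : ¬ WeilSector) : SummitOffWeilSector :=
  fun hW => absurd hW h

theorem not_hodgeConjecture_of_not_weilSector (h : ¬ WeilSector) : ¬ _root_.HodgeConjecture :=
  fun hHC => h (weilSector_of_hodgeConjecture hHC)

/-- The sector contains every other item of the route: target, support and the three rung cruxes.
(So a kill of THIS crux would, by `not_summitOffWeilSector_iff`, prove all of them.) -/
theorem weilSector_consequences (hW : WeilSector) :
    HodgeWeilLadder ∧ WeilDescending ∧ WeilSixfoldsSqrtMinus7 ∧ WeilTwelvefoldsSqrtMinus7 ∧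
      WeilTenfoldsSqrtMinus11 := by
  refine ⟨?_, ?_, ?_, ?_, ?_⟩
  · intro p hp h4 h7 g hg n hn
    have h1 : 1 ≤ (p - 1) / 2 := by omega
    have h2 : 1 ≤ g - 1 := by omega
    have h3 : 1 ≤ n := by
      rw [hn]
      exact Nat.mul_le_mul h1 h2
    exact hW p hp h4 h7 n h3
  · intro p hp h4 h7 n hn _
    exact hW p hp h4 h7 n hn
  · intro A φ hdim hφ c hrat hhodge heig
    exact hW 7 (by norm_num) (by norm_num) (by norm_num) 3 (by norm_num) A φ hdim
      (by exact_mod_cast hφ) c hrat hhodge (by exact_mod_cast heig)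
  · intro A φ hdim hφ c hrat hhodge heig
    exact hW 7 (by norm_num) (by norm_num) (by norm_num) 6 (by norm_num) A φ hdim
      (by exact_mod_cast hφ) c hrat hhodge (by exact_mod_cast heig)
  · intro A φ hdim hφ c hrat hhodge heig
    exact hW 11 (by norm_num) (by norm_num) (by norm_num) 5 (by norm_num) A φ hdim
      (by exact_mod_cast hφ) c hrat hhodge (by exact_mod_cast heig)

/-- Once the route's positive work (`WeilSector`, i.e. Ladder + Descending) is done, the crux IS the
summit: nothing weaker than `HodgeConjecture` remains. -/
theorem summitOffWeilSector_iff_hodgeConjecture_of_weilSector (hW : WeilSector) :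
    SummitOffWeilSector ↔ _root_.HodgeConjecture :=
  ⟨fun h => h hW, fun h _ => h⟩

/-- Packaging: what a refutation of the crux would deliver. -/
theorem consequences_of_not_summitOffWeilSector (h : ¬ SummitOffWeilSector) :
    (HodgeWeilLadder ∧ WeilDescending ∧ WeilSixfoldsSqrtMinus7 ∧ WeilTwelvefoldsSqrtMinus7 ∧
      WeilTenfoldsSqrtMinus11) ∧ ¬ _root_.HodgeConjecture :=
  ⟨weilSector_consequences (not_summitOffWeilSector_iff.1 h).1, (not_summitOffWeilSector_iff.1 h).2⟩

/-! ## §2b (cycle 2) The antecedent is EXACTLY the route's positive work: `WeilSector ↔ Ladder ∧ Descending`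

So the crux is the route's deciding implication with itself deleted. LANDED (negative forms):
`Theorems/SummitOffWeilSector/Negative/RouteComplement.lean`. -/

/-- Generic ladder descent over an abstract rung predicate (the arithmetic core of the route's
deciding theorem `closes`, isolated): rungs at `n = M (g - 1)`, `g ≥ 2`, plus one-step descending
give every `n ≥ 1`. -/
theorem ladder_descent (P : ℕ → Prop) (M : ℕ) (hM : 1 ≤ M)
    (hLad : ∀ g : ℕ, 2 ≤ g → ∀ n : ℕ, n = M * (g - 1) → P n)
    (hDesc : ∀ n : ℕ, 1 ≤ n → (∀ m : ℕ, m = n + 1 → P m) → P n) :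
    ∀ n : ℕ, 1 ≤ n → P n := by
  intro n hn
  have key : ∀ d k : ℕ, 1 ≤ k → k + d = M * n → P k := by
    intro d
    induction d with
    | zero =>
      intro k hk hkd
      refine hLad (n + 1) (by omega) k ?_
      rw [Nat.add_sub_cancel]
      omega
    | succ d ih =>
      intro k hk hkd
      exact hDesc k hk fun m hm => ih m (by omega) (by omega)
  have hMn : n ≤ M * n :=
    calc n = 1 * n := (Nat.one_mul n).symm
      _ ≤ M * n := Nat.mul_le_mul_right n hM
  exact key (M * n - n) n hn (by omega)

/-- `Ladder → Descending → WeilSector` (the content of `closes` minus its last step). -/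
theorem weilSector_of_ladder_of_descending (hL : HodgeWeilLadder) (hD : WeilDescending) :
    WeilSector := by
  intro p hp hp4 hp7
  exact ladder_descent (WeilRung p) ((p - 1) / 2) (by omega)
    (fun g hg n hn => hL p hp hp4 hp7 g hg n hn) (fun n hn ih => hD p hp hp4 hp7 n hn ih)

/-- `WeilSector → Ladder` (rungs `g ≥ 2` have `n = (p-1)/2 · (g-1) ≥ 1`). -/
theorem ladder_of_weilSector (hW : WeilSector) : HodgeWeilLadder := by
  intro p hp h4 h7 g hg n hn
  have h1 : 1 ≤ (p - 1) / 2 := by omega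
  have h2 : 1 ≤ g - 1 := by omega
  have h3 : 1 ≤ n := by
    rw [hn]
    exact Nat.mul_le_mul h1 h2
  exact hW p hp h4 h7 n h3

/-- `WeilSector → Descending` (the conclusion of the descending step is a rung). -/
theorem descending_of_weilSector (hW : WeilSector) : WeilDescending := by
  intro p hp h4 h7 n hn _
  exact hW p hp h4 h7 n hn

/-- **The antecedent of the crux is exactly the conjunction of the route's target and support.** -/
theorem weilSector_iff_ladder_and_descending :
    WeilSector ↔ (HodgeWeilLadder ∧ WeilDescending) :=
  ⟨fun h => ⟨ladder_of_weilSector h, descending_of_weilSector h⟩,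
    fun h => weilSector_of_ladder_of_descending h.1 h.2⟩

/-- **The crux is the route's deciding implication with itself deleted.** -/
theorem summitOffWeilSector_iff_routeCore :
    SummitOffWeilSector ↔ (HodgeWeilLadder → WeilDescending → _root_.HodgeConjecture) := by
  rw [summitOffWeilSector_iff, weilSector_iff_ladder_and_descending, and_imp]

/-- **Exact negation in route terms**: the crux fails iff the route's target and support hold and the
Hodge conjecture fails. -/
theorem not_summitOffWeilSector_iff_route :
    ¬ SummitOffWeilSector ↔ (HodgeWeilLadder ∧ WeilDescending ∧ ¬ _root_.HodgeConjecture) := by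
  rw [summitOffWeilSector_iff, weilSector_iff_ladder_and_descending, Classical.not_imp, and_assoc]

/-- Under the route's target and support the crux IS the summit, verbatim. -/
theorem summitOffWeilSector_iff_hodgeConjecture_of_ladder (hL : HodgeWeilLadder) (hD : WeilDescending) :
    SummitOffWeilSector ↔ _root_.HodgeConjecture :=
  summitOffWeilSector_iff_hodgeConjecture_of_weilSector (weilSector_of_ladder_of_descending hL hD)

/-- Rev 10–13 of the route file (2026-08-16) added the glue item
`LadderGlue : HeckePrymAnchors → WeilVariationalHodge → IsoInvariance → ProductDescent → WeilDescending →
HodgeWeilLadder`. So under ALL the route's other items the crux is, again verbatim, the summit: the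
Hecke–Prym mechanism (anchors, variational Hodge, descents) contributes nothing to it. -/
theorem summitOffWeilSector_iff_hodgeConjecture_of_route (hG : LadderGlue) (hA : HeckePrymAnchors)
    (hV : WeilVariationalHodge) (hI : IsoInvariance) (hP : ProductDescent) (hD : WeilDescending) :
    SummitOffWeilSector ↔ _root_.HodgeConjecture :=
  summitOffWeilSector_iff_hodgeConjecture_of_ladder (hG hA hV hI hP hD) hD

/-- … equivalently, in negative form: with the whole positive route done, refuting the crux is exactly
refuting the Hodge conjecture. -/
theorem not_summitOffWeilSector_iff_of_route (hG : LadderGlue) (hA : HeckePrymAnchors)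
    (hV : WeilVariationalHodge) (hI : IsoInvariance) (hP : ProductDescent) (hD : WeilDescending) :
    ¬ SummitOffWeilSector ↔ ¬ _root_.HodgeConjecture :=
  not_congr (summitOffWeilSector_iff_hodgeConjecture_of_route hG hA hV hI hP hD)

/-- Hence the route item `Assembly` (`Ladder → Descending → OffSector → HC`) is a tautology — it
holds with the crux instantiated by ITSELF, independently of any mathematics. -/
theorem assembly_tautology :
    HodgeWeilLadder → WeilDescending → SummitOffWeilSector → _root_.HodgeConjecture :=
  fun hL hD hS => hS (weilSector_of_ladder_of_descending hL hD)

/-! ## §2c (cycle 2) Sandwich: `HC → crux → (HC for abelian varieties → HC)`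

Even granting the Hodge conjecture for EVERY abelian variety (all `K`, all exceptional classes), the
crux still asserts the Hodge conjecture for every smooth projective variety: it is at least as strong as
the reduction "HC for abelian varieties ⇒ HC", for which no mechanism is in print (Kuga–Satake reaches
only `H²` of K3 type; the item's own docstring: "no reduction of general HC to abelian varieties is
known"). -/

/-- The Hodge conjecture for all complex abelian varieties (in the summit's own spelling). -/
def HodgeConjectureForAbelianVarieties : Prop :=
  ∀ A : AbelianVariety ℂ, HodgeConjectureFor A.dim A.X

/-- `HC → HC_ab` (abelian varieties are smooth projective of dimension `dim A`). -/
theorem hcAbelian_of_hodgeConjecture (hHC : _root_.HodgeConjecture) : HodgeConjectureForAbelianVarieties :=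
  fun A => hHC (AbelianVariety.isSmoothProjective_holds (A := A))

/-- `HC_ab → WeilSector`: the sector is a small part of the Hodge conjecture for abelian varieties. -/
theorem weilSector_of_hcAbelian (h : HodgeConjectureForAbelianVarieties) : WeilSector := by
  intro p _ _ _ n _ A φ hdim _ c hrat hhodge _
  have hA : HodgeConjectureFor (2 * n) A.X := hdim ▸ h A
  exact hA.2 n c hrat hhodge

/-- **Lower bound on the crux**: it implies the abelian-to-all reduction of the Hodge conjecture. -/
theorem abelian_to_all_of_summitOffWeilSector (hS : SummitOffWeilSector) :
    HodgeConjectureForAbelianVarieties → _root_.HodgeConjecture :=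
  fun h => hS (weilSector_of_hcAbelian h)

/-- Under HC for abelian varieties (which the route's own crux `WeilVariationalHodge`, stmt-14497, implies
on paper — ideator-3 barrier note B9, `Cruxes/SummitOffWeilSector/BarrierNotesIdeator3Gen1.md`) the crux is
the summit verbatim; its honest residue is "HC off abelian varieties". -/
theorem summitOffWeilSector_iff_hodgeConjecture_of_hcAbelian (h : HodgeConjectureForAbelianVarieties) :
    SummitOffWeilSector ↔ _root_.HodgeConjecture :=
  summitOffWeilSector_iff_hodgeConjecture_of_weilSector (weilSector_of_hcAbelian h)

/-- Negative form: whoever refutes the abelian-to-all reduction (HC for all abelian varieties but a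
non-algebraic Hodge class on some non-abelian variety) refutes the crux. -/
theorem not_summitOffWeilSector_of_hcAbelian_of_not_hc (h : HodgeConjectureForAbelianVarieties)
    (hn : ¬ _root_.HodgeConjecture) : ¬ SummitOffWeilSector :=
  fun hS => hn (abelian_to_all_of_summitOffWeilSector hS h)

/-! ## §3 Load-bearing analysis (the antecedent's hypotheses are anti-load-bearing) -/

/-- ANTI-LOAD-BEARING, formally: any STRONGER antecedent `W'` (e.g. the sector with `IsOfHodgeType`,
`IsRationalClass`, the eigenspace condition, `φ ≫ φ = -p` or `7 ≤ p` dropped — each such variant asserts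
algebraicity for more classes, hence implies `WeilSector`) gives a WEAKER crux. So no hypothesis inside
the antecedent can be "needed" by a proof of the crux; the difficulty sits entirely in the conclusion. -/
theorem variant_of_stronger_antecedent {W' : Prop} (hW : W' → WeilSector) :
    SummitOffWeilSector → (W' → _root_.HodgeConjecture) :=
  fun h w => h (hW w)

/-- Conversely a WEAKER antecedent `W'` (more side conditions) gives a STRONGER crux, but never one
stronger than `HodgeConjecture` itself. -/
theorem variant_of_weaker_antecedent {W' : Prop} (_hW : WeilSector → W') :
    _root_.HodgeConjecture → (W' → _root_.HodgeConjecture) :=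
  fun h _ => h

/-- The `n = 0` rung is TRUE outright: `algebraicClasses A.X 0 = ⊤`. So `1 ≤ n` in the antecedent is
decoration (information for the planner; harmless). -/
theorem weilRung_zero (p : ℕ) : WeilRung p 0 := by
  intro A φ _ _ c _ _ _
  have h : c ∈ algebraicClasses A.X 0 := by
    rw [algebraicClasses_zero]
    exact Submodule.mem_top
  simpa using h

/-- The antecedent with `n ≥ 0` allowed. -/
def WeilSectorWithZero : Prop :=
  ∀ p : ℕ, p.Prime → p % 4 = 3 → 7 ≤ p → ∀ n : ℕ, WeilRung p n

theorem weilSectorWithZero_iff : WeilSectorWithZero ↔ WeilSector := by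
  refine ⟨fun h p hp h4 h7 n _ => h p hp h4 h7 n, fun h p hp h4 h7 n => ?_⟩
  rcases Nat.eq_zero_or_pos n with rfl | hn
  · exact weilRung_zero p
  · exact h p hp h4 h7 n hn

/-- `SummitOffWeilSector` without the side condition `1 ≤ n` in its antecedent: equivalent. -/
def SummitOffWeilSectorWithoutPosN : Prop := WeilSectorWithZero → _root_.HodgeConjecture

theorem summitOffWeilSector_iff_withZero : SummitOffWeilSector ↔ SummitOffWeilSectorWithoutPosN := by
  rw [summitOffWeilSector_iff, SummitOffWeilSectorWithoutPosN, weilSectorWithZero_iff]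

/-! ## §4 Eigenvalue separation for ALL rungs: `(1+i√p)ⁿ ≠ (1-i√p)ⁿ` (`p` prime, `p ≠ 3`, `n ≥ 1`)

Write `t = i√p` (`t² = -p`) and `(1 + t)ⁿ = Aₙ + Bₙ t` with integers `(Aₙ, Bₙ) = weilAB p n`:
`(A₀, B₀) = (1, 0)`, `(Aₙ₊₁, Bₙ₊₁) = (Aₙ - p Bₙ, Aₙ + Bₙ)`. Then `(1 - t)ⁿ = Aₙ - Bₙ t`, so the two pure
Weil eigenvalues coincide iff `Bₙ = 0`. Invariants: `Aₙ ≡ 1 (mod p)`; `Aₙ² + p Bₙ² = (1+p)ⁿ`;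
`(A₂ₘ, B₂ₘ) = (Aₘ² - p Bₘ², 2 Aₘ Bₘ)`. Descent: `n` odd and `Bₙ = 0` give `Aₙ² = (1+p)ⁿ`, so `1 + p` is a
square, `p = (s-1)(s+1)`, `p = 3`; `n = 2m` and `B₂ₘ = 0` give `Aₘ Bₘ = 0`, `Aₘ ≠ 0` (`≡ 1 mod p`), so
`Bₘ = 0`, contradiction by induction. -/

/-- `(Aₙ, Bₙ)` with `(1 + t)ⁿ = Aₙ + Bₙ·t` whenever `t² = -p`. -/
def weilAB (p : ℕ) : ℕ → ℤ × ℤ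
  | 0 => (1, 0)
  | n + 1 => ((weilAB p n).1 - (p : ℤ) * (weilAB p n).2, (weilAB p n).1 + (weilAB p n).2)

@[simp] theorem weilAB_zero (p : ℕ) : weilAB p 0 = (1, 0) := rfl

@[simp] theorem weilAB_succ (p n : ℕ) :
    weilAB p (n + 1) =
      ((weilAB p n).1 - (p : ℤ) * (weilAB p n).2, (weilAB p n).1 + (weilAB p n).2) := rfl

/-- The excluded prime really fails: for `p = 3`, `B₃ = 0`, i.e. `(1+i√3)³ = (1-i√3)³ (= -8)`. -/
theorem weilAB_three_three : weilAB 3 3 = (-8, 0) := by decide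

/-- `(1 + t)ⁿ = Aₙ + Bₙ t` for `t² = -p` (any commutative ring). -/
theorem one_add_pow_eq {R : Type*} [CommRing R] {p : ℕ} {t : R} (ht : t ^ 2 = -(p : R)) (n : ℕ) :
    (1 + t) ^ n = ((weilAB p n).1 : R) + ((weilAB p n).2 : R) * t := by
  induction n with
  | zero => simp
  | succ n ih =>
    rw [pow_succ, ih, weilAB_succ]
    push_cast
    linear_combination ((weilAB p n).2 : R) * ht

/-- `(1 - t)ⁿ = Aₙ - Bₙ t` for `t² = -p`. -/
theorem one_sub_pow_eq {R : Type*} [CommRing R] {p : ℕ} {t : R} (ht : t ^ 2 = -(p : R)) (n : ℕ) :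
    (1 - t) ^ n = ((weilAB p n).1 : R) - ((weilAB p n).2 : R) * t := by
  have ht' : (-t) ^ 2 = -(p : R) := by rw [neg_sq]; exact ht
  have h := one_add_pow_eq ht' n
  rw [← sub_eq_add_neg] at h
  rw [h]
  ring

/-- Invariant 1: `Aₙ ≡ 1 (mod p)`. -/
theorem weilAB_fst_modEq (p n : ℕ) : (weilAB p n).1 ≡ 1 [ZMOD p] := by
  induction n with
  | zero => simp [Int.ModEq]
  | succ n ih =>
    rw [weilAB_succ]
    calc (weilAB p n).1 - (p : ℤ) * (weilAB p n).2
        ≡ 1 - 0 [ZMOD p] := by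
          refine Int.ModEq.sub ih ?_
          exact (Int.modEq_zero_iff_dvd.2 (dvd_mul_right _ _))
      _ = 1 := by ring

/-- Hence `Aₙ ≠ 0` as soon as `p ≠ 1`. -/
theorem weilAB_fst_ne_zero {p : ℕ} (hp : p ≠ 1) (n : ℕ) : (weilAB p n).1 ≠ 0 := by
  intro h
  have h1 := weilAB_fst_modEq p n
  rw [h] at h1
  have h2 : (p : ℤ) ∣ 1 - 0 := Int.ModEq.dvd h1
  simp only [sub_zero] at h2
  have : (p : ℤ).natAbs ∣ 1 := by exact_mod_cast Int.natAbs_dvd_natAbs.2 h2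
  simp only [Int.natAbs_natCast, Nat.dvd_one] at this
  exact hp this

/-- Invariant 2 (norm): `Aₙ² + p Bₙ² = (1 + p)ⁿ`. -/
theorem weilAB_norm (p n : ℕ) :
    (weilAB p n).1 ^ 2 + (p : ℤ) * (weilAB p n).2 ^ 2 = (1 + (p : ℤ)) ^ n := by
  induction n with
  | zero => simp
  | succ n ih =>
    rw [weilAB_succ]
    linear_combination (1 + (p : ℤ)) * ih

/-- Addition formula: `(A, B)_{m+k} = (A_m A_k - p B_m B_k, A_m B_k + A_k B_m)`. -/
theorem weilAB_add (p m k : ℕ) :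
    weilAB p (m + k) =
      ((weilAB p m).1 * (weilAB p k).1 - (p : ℤ) * (weilAB p m).2 * (weilAB p k).2,
        (weilAB p m).1 * (weilAB p k).2 + (weilAB p k).1 * (weilAB p m).2) := by
  induction k with
  | zero => simp
  | succ k ih =>
    rw [Nat.add_succ, weilAB_succ, ih, weilAB_succ]
    ext <;> simp only <;> ring

/-- Doubling: `B₂ₘ = 2 Aₘ Bₘ`. -/
theorem weilAB_snd_two_mul (p m : ℕ) :
    (weilAB p (2 * m)).2 = 2 * (weilAB p m).1 * (weilAB p m).2 := by
  rw [two_mul, weilAB_add]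
  ring

/-- `p + 1` is a perfect square only for the prime `p = 3`. -/
theorem prime_add_one_sq {p : ℕ} (hp : p.Prime) {s : ℤ} (hs : s ^ 2 = 1 + (p : ℤ)) : p = 3 := by
  -- `p = (|s| - 1)(|s| + 1)`
  have hs' : (s.natAbs : ℤ) ^ 2 = 1 + (p : ℤ) := by rw [Int.natAbs_sq] ; exact hs
  set a := s.natAbs with ha
  have ha1 : 1 ≤ a := by
    rcases Nat.eq_zero_or_pos a with h0 | h0
    · exfalso
      rw [h0] at hs'
      norm_num at hs'
      have := hp.pos
      omega
    · exact h0
  have hfac : p = (a - 1) * (a + 1) := by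
    have h1 : ((a : ℤ) - 1) * ((a : ℤ) + 1) = (p : ℤ) := by linear_combination hs'
    have h2 : (((a - 1 : ℕ) : ℤ)) * ((a + 1 : ℕ) : ℤ) = (p : ℤ) := by
      push_cast [Nat.cast_sub ha1]
      linear_combination h1
    exact_mod_cast h2.symm
  rw [hfac] at hp
  rcases (Nat.prime_mul_iff.1 hp) with ⟨_, h2⟩ | ⟨_, h1⟩
  · omega
  · have : a = 2 := by omega
    rw [hfac, this]

/-- An odd power which is a perfect square has a perfect-square base (over `ℤ`, positive base). -/
theorem isSquare_of_pow_odd_eq_sq {x a : ℤ} (hx : 0 < x) {n : ℕ} (hn : Odd n) (h : a ^ 2 = x ^ n) :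
    ∃ s : ℤ, s ^ 2 = x := by
  obtain ⟨k, rfl⟩ := hn
  -- x = (a / x^k)^2 in ℚ
  have hxk : (x : ℚ) ^ k ≠ 0 := pow_ne_zero _ (by exact_mod_cast hx.ne')
  have hq : IsSquare (x : ℚ) := by
    refine ⟨(a : ℚ) / (x : ℚ) ^ k, ?_⟩
    have h' : ((a : ℚ)) ^ 2 = (x : ℚ) ^ (2 * k + 1) := by exact_mod_cast h
    field_simp
    rw [h']
    ring
  have hz : IsSquare x := by exact_mod_cast (Rat.isSquare_intCast_iff).1 hq
  obtain ⟨s, hs⟩ := hz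
  exact ⟨s, by rw [hs]; ring⟩

/-- MAIN LEMMA of §4: for a prime `p ≠ 3` and `n ≥ 1`, `Bₙ ≠ 0`. -/
theorem weilAB_snd_ne_zero {p : ℕ} (hp : p.Prime) (hp3 : p ≠ 3) {n : ℕ} (hn : 1 ≤ n) :
    (weilAB p n).2 ≠ 0 := by
  induction n using Nat.strong_induction_on with
  | _ n ih =>
    intro hB
    rcases Nat.even_or_odd n with ⟨m, rfl⟩ | hodd
    · -- n = m + m = 2 * m
      have hm : 1 ≤ m := by omega
      have h2 := weilAB_snd_two_mul p m
      rw [two_mul] at h2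
      rw [hB] at h2
      have h0 : (weilAB p m).1 * (weilAB p m).2 = 0 := by linarith
      rcases mul_eq_zero.1 h0 with hA | hB'
      · exact weilAB_fst_ne_zero hp.one_lt.ne' m hA
      · exact ih m (by omega) hm hB'
    · -- n odd: norm identity makes 1 + p a square
      have hnorm := weilAB_norm p n
      rw [hB] at hnorm
      simp only [ne_eq, OfNat.ofNat_ne_zero, not_false_eq_true, zero_pow, mul_zero, add_zero] at hnorm
      have hpos : (0 : ℤ) < 1 + (p : ℤ) := by positivity
      obtain ⟨s, hs⟩ := isSquare_of_pow_odd_eq_sq hpos hodd hnorm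
      exact hp3 (prime_add_one_sq hp hs)

/-- §4 payoff, abstract form: in any commutative ring where `2pt ≠ 0`-type cancellations hold — we state
it over `ℂ` with `t = i√p`: `(1 + i√p)ⁿ ≠ (1 - i√p)ⁿ` for prime `p ≠ 3`, `n ≥ 1`. -/
theorem weil_pow_ne_conj_pow {p : ℕ} (hp : p.Prime) (hp3 : p ≠ 3) {n : ℕ} (hn : 1 ≤ n) :
    (1 + I * (Real.sqrt (p : ℝ) : ℂ)) ^ n ≠ (1 - I * (Real.sqrt (p : ℝ) : ℂ)) ^ n := by
  set t : ℂ := I * (Real.sqrt (p : ℝ) : ℂ) with ht_def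
  have ht : t ^ 2 = -(p : ℂ) := by
    rw [ht_def, mul_pow, I_sq, ← Complex.ofReal_pow, Real.sq_sqrt (Nat.cast_nonneg p)]
    push_cast
    ring
  have ht0 : t ≠ 0 := by
    rw [ht_def]
    refine mul_ne_zero I_ne_zero ?_
    exact_mod_cast (Real.sqrt_pos.2 (by exact_mod_cast hp.pos)).ne'
  rw [one_add_pow_eq ht, one_sub_pow_eq ht]
  intro h
  have h2 : (2 : ℂ) * ((weilAB p n).2 : ℂ) * t = 0 := by linear_combination h
  rcases mul_eq_zero.1 h2 with h3 | h3
  · rcases mul_eq_zero.1 h3 with h4 | h4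
    · norm_num at h4
    · exact weilAB_snd_ne_zero hp hp3 hn (by exact_mod_cast h4)
  · exact ht0 h3

/-- No mixed Künneth–Hodge eigenvalue is a pure one: for `b ≥ 1`,
`(1+i√p)ᵃ(1-i√p)ᵇ ≠ (1+i√p)ᵃ⁺ᵇ` (and symmetrically). -/
theorem mixed_ne_pure_pos {p : ℕ} (hp : p.Prime) (hp3 : p ≠ 3) (a : ℕ) {b : ℕ} (hb : 1 ≤ b) :
    (1 + I * (Real.sqrt (p : ℝ) : ℂ)) ^ a * (1 - I * (Real.sqrt (p : ℝ) : ℂ)) ^ b ≠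
      (1 + I * (Real.sqrt (p : ℝ) : ℂ)) ^ (a + b) := by
  intro h
  rw [pow_add] at h
  have hne : (1 + I * (Real.sqrt (p : ℝ) : ℂ)) ^ a ≠ 0 := by
    apply pow_ne_zero
    intro h0
    have := congrArg Complex.re h0
    simp at this
  have := mul_left_cancel₀ hne h
  exact weil_pow_ne_conj_pow hp hp3 hb this.symm

theorem mixed_ne_pure_neg {p : ℕ} (hp : p.Prime) (hp3 : p ≠ 3) {a : ℕ} (ha : 1 ≤ a) (b : ℕ) :
    (1 + I * (Real.sqrt (p : ℝ) : ℂ)) ^ a * (1 - I * (Real.sqrt (p : ℝ) : ℂ)) ^ b ≠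
      (1 - I * (Real.sqrt (p : ℝ) : ℂ)) ^ (a + b) := by
  intro h
  rw [pow_add] at h
  have hne : (1 - I * (Real.sqrt (p : ℝ) : ℂ)) ^ b ≠ 0 := by
    apply pow_ne_zero
    intro h0
    have := congrArg Complex.re h0
    simp at this
  have := mul_right_cancel₀ hne h
  exact weil_pow_ne_conj_pow hp hp3 ha this

/-- The two Weil eigenvalues of every rung of `WeilSector` are distinct (`p ≡ 3 (4)`, `p ≥ 7` ⊋ what is
needed: `p` prime, `p ≠ 3`). -/
theorem weilSector_eigenvalues_ne {p : ℕ} (hp : p.Prime) (h7 : 7 ≤ p) {n : ℕ} (hn : 1 ≤ n) :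
    (1 + I * (Real.sqrt (p : ℝ) : ℂ)) ^ (2 * n) ≠ (1 - I * (Real.sqrt (p : ℝ) : ℂ)) ^ (2 * n) :=
  weil_pow_ne_conj_pow hp (by omega) (by omega)

/-! ## §5 (reworked, cycle 2) The one junk vector: uninhabitability of `HodgeModel`

`IsOfHodgeType n X k p q c := ∃ M : HodgeModel n X, …` and
`HodgeConjectureFor n X := Nonempty (HodgeModel n X) ∧ …`. If Hodge models of positive-dimensional
abelian varieties could not exist, the sector would be vacuous and the summit false. The hypothesis
is the negation of the named fact `HodgeTheory.nonempty_hodgeModel` (a printed theorem), so these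
implications document the junk-safety of the statement; they are not a route to a kill. -/

/-- A class can be of some Hodge type only through a Hodge model. -/
theorem isOfHodgeType_nonempty {n : ℕ} {X : SchemeOver ℂ} {k p q : ℕ}
    {c : Literature.AlgebraicTopology.SingularHomology.singularCohomology ℂ ℂ (ComplexPoints X) k}
    (h : IsOfHodgeType n X k p q c) : Nonempty (HodgeModel n X) :=
  ⟨h.choose⟩

/-- Junk direction 1: with no Hodge model in dimension `2n`, the rung `WeilRung p n` holds VACUOUSLY. -/
theorem weilRung_of_isEmpty_hodgeModel (p n : ℕ)
    (h : ∀ A : AbelianVariety ℂ, A.dim = 2 * n → IsEmpty (HodgeModel (2 * n) A.X)) :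
    WeilRung p n := by
  intro A φ hdim _ c _ hhodge _
  obtain ⟨M, _⟩ := hhodge
  exact ((h A hdim).false M).elim

/-- … hence the whole sector would hold vacuously. -/
theorem weilSector_of_isEmpty_hodgeModel
    (h₁ : ∀ A : AbelianVariety ℂ, 1 ≤ A.dim → IsEmpty (HodgeModel A.dim A.X)) : WeilSector := by
  intro p _ _ _ n hn
  refine weilRung_of_isEmpty_hodgeModel p n fun A hdim => ?_
  have h := h₁ A (by omega)
  rwa [hdim] at h

/-- Junk direction 2: an abelian variety without Hodge model refutes the summit (abelian varieties are
smooth projective: the tree's proved `AbelianVariety.isSmoothProjective_holds`). -/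
theorem not_hodgeConjecture_of_isEmpty_hodgeModel {A : AbelianVariety ℂ}
    (h : IsEmpty (HodgeModel A.dim A.X)) : ¬ _root_.HodgeConjecture := by
  intro hHC
  have hsp : IsSmoothProjective A.dim A.X := AbelianVariety.isSmoothProjective_holds (A := A)
  obtain ⟨M⟩ := (hHC hsp).1
  exact h.false M

/-- **The junk vector, assembled**: uninhabitable Hodge models of positive-dimensional abelian varieties
plus one positive-dimensional abelian variety would kill the crux. (`h₁` is FALSE on paper.) -/
theorem not_summitOffWeilSector_of_isEmpty_hodgeModel
    (h₁ : ∀ A : AbelianVariety ℂ, 1 ≤ A.dim → IsEmpty (HodgeModel A.dim A.X))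
    (h₂ : ∃ A : AbelianVariety ℂ, 1 ≤ A.dim) : ¬ SummitOffWeilSector := by
  intro hS
  obtain ⟨A, hA⟩ := h₂
  exact not_hodgeConjecture_of_isEmpty_hodgeModel (h₁ A hA)
    (hS (weilSector_of_isEmpty_hodgeModel h₁))

/-- … and `h₁ ∧ h₂` is exactly a refutation of the Literature named fact `nonempty_hodgeModel`
(Serre GAGA §2 + de Rham 1931 + Hodge decomposition, Voisin I Thm. 6.18): the vector is closed on paper. -/
theorem isEmpty_hodgeModel_contradicts_namedFact
    (h₁ : ∀ A : AbelianVariety ℂ, 1 ≤ A.dim → IsEmpty (HodgeModel A.dim A.X))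
    (h₂ : ∃ A : AbelianVariety ℂ, 1 ≤ A.dim) :
    ¬ ∀ (n : ℕ) (X : SchemeOver ℂ), nonempty_hodgeModel n X := by
  intro hfact
  obtain ⟨A, hA⟩ := h₂
  obtain ⟨M⟩ := hfact A.dim A.X (AbelianVariety.isSmoothProjective_holds (A := A))
  exact (h₁ A hA).false M

/-- Conversely the summit as typed already contains the existence of Hodge models of all abelian
varieties (its anti-vacuity conjunct). -/
theorem hodgeConjecture_imp_nonempty_hodgeModel (hHC : _root_.HodgeConjecture) (A : AbelianVariety ℂ) :
    Nonempty (HodgeModel A.dim A.X) :=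
  (hHC (AbelianVariety.isSmoothProjective_holds (A := A))).1

/-- Under the named fact the summit is exactly its cycle part (so the crux is `WeilSector →` "rational
`(p,p)`-classes are algebraic on every smooth projective `X`", nothing hidden in the first conjunct). -/
theorem hodgeConjecture_iff_cyclePart_of_namedFact
    (hfact : ∀ (n : ℕ) (X : SchemeOver ℂ), nonempty_hodgeModel n X) :
    _root_.HodgeConjecture ↔ ∀ ⦃n : ℕ⦄ ⦃X : SchemeOver ℂ⦄, IsSmoothProjective n X →
      ∀ (p : ℕ) (c : Literature.AlgebraicTopology.SingularHomology.singularCohomology ℂ ℂ (ComplexPoints X) (2 * p)),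
        IsRationalClass c → IsOfHodgeType n X (2 * p) p p c → c ∈ algebraicClasses X p := by
  constructor
  · intro h n X hX
    exact (h hX).2
  · intro h n X hX
    exact ⟨hfact n X hX, h hX⟩

/-- The only abelian variety over `ℂ` the tree can build today has dimension `0`; the antecedent's rungs
start at dimension `2`, and the `n = 0` rung needs no input at all. -/
example (p : ℕ) : WeilRung p 0 := weilRung_zero p

/-! ## §6 (cycle 2) Natural strengthenings: none Lean-refutable (module docstring item 7) -/

/-! ## §7 Targets (lead's stuck stubs): none (payload.targets = [], stuck_stubs = [] at cycle 2) -/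

-- NEAR-MISSES: none recorded this cycle (every statement attempted above is closed).

end Summit.HodgeConjecture.HodgeConjecture.Cruxes.SummitOffWeilSector.Disproof

end
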